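import Literature.MathematicalPhysics.QuantumFieldTheory.LatticeGaugeDobrushin
import Literature.MathematicalPhysics.QuantumLattice.BalabanRGHaarIterates
import Literature.Probability.LatticeModels.DobrushinTiltSharp
import Summits.Ventures.YMGap.Thresholds.PressureDerivative
import Literature.Barriers.QuantumFields.DiscreteSubgroupFreezing
import HarnessLib

/-!
# The every-group strong-coupling corner, SHARP COUNT: two distinct links lie on at most one plaquette, hence DLR
# uniqueness of lattice Yang–Mills for EVERY compact gauge group at `6(d−1) C_ρ |β| < 1`

Cell `pub-ymgap`, seat ds-1 (gen 14), companion of `StrongCouplingAllGroups` (file 1 of the «ONE-STATE-G» object). HONEST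
FRAMING: strong-coupling LATTICE statements for the Wilson action of an ARBITRARY compact metrisable gauge group `G`,
continuous representation `ρ` with `|Re tr ρ(U_p)| ≤ C_ρ`, every `d`, both signs of `β`; a total-variation Dobrushin corner whose
content is generality, not the number. File 1 bounded the change of the one-link energy `S_{x}` under a modification of ONE
other link `y` through ALL `2(d−1)` plaquettes containing `y`; in fact only plaquettes containing BOTH `x` and `y` matter, and
there is AT MOST ONE (§1, pure `ℤ^d` combinatorics). The influence coefficient drops from `2(d−1) C_ρ |β|` to `C_ρ |β|` and the
door from `12(d−1)² C_ρ |β| < 1` to `6(d−1) C_ρ |β| < 1` (§2–3). Rows: compact `U(1)`, `d = 4`: a unique DLR state for `|β| < 1/18`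
(file 1: `1/108`), `d = 3`: `1/12`; `SU(2)`, `d = 4`: `|β| < 1/36` (file 1: `1/216`; still ×6.5 inside the tree's vertex-star
window `9/50` — the every-group formula is not the tool for `SU(N)`). The sharp CLUSTERING bound (with `c = 6(d−1) C_ρ |β|`) needs
file 1's oscillation lemma and rides a successor file once file 1 is built. Nothing about weak coupling, the continuum, or
Clay. Kernel theorems only, 0 compute.

1. `fst_apply_eq_min`, `dirs_eq`, ★ `eq_of_mem_plaquetteEdges`, ★ `card_filter_pair_le_one` — two distinct links determine the
   plaquette through them (base point = coordinatewise minimum of the two base points; directions = the links' directions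
   together with the coordinates where the base points differ); `abs_wilsonBoundaryAction_singleton_sub_le_sharp` — the
   oscillation of `S_{x}` under a change at `y ≠ x` is `≤ 2 C_ρ`.
2. `isKRContraction_ymSpecification_sharp` — Dobrushin's condition in the total-variation form with influence `C_ρ |β|`
   (Simon's lemma `abs_integral_tilted_sub_integral_tilted_le_linear'` on the tilted Haar one-link laws).
3. ★ `hasUniqueGibbsMeasure_sharp` — `|𝒢(β)| = 1` at `6(d−1) C_ρ |β| < 1` (Föllmer's theorem
   `subsingleton_gibbsMeasures_of_isKRContraction`, discrete weight, Urysohn metric on `G` for the σ-algebra bookkeeping);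
   `tendsto_integral_torusState_sharp` (THE state is the full-sequence torus limit), `isZdTranslationInvariant_sharp`;
   rows `hasUniqueGibbsMeasure_sharp_of_unitary`, ★ `u1_four_hasUniqueGibbsMeasure_sharp` (`1/18`), `u1_three_…` (`1/12`),
   ★ `zn_four_hasUniqueGibbsMeasure_sharp` (discrete `ℤ_n`, every `n`, `d = 4`: `1/18`), `suN_hasUniqueGibbsMeasure_sharp`,
   `su2_four_hasUniqueGibbsMeasure_sharp` (`1/36`).

References (in the tree): Dobrushin 1968; Simon, CMP 68 (1979) 183; Föllmer, LNM 1362 (1988) Ch. I; Georgii (2011) Thm. 8.7, Prop. 8.8.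
-/

noncomputable section

open MeasureTheory Filter Topology ProbabilityTheory Function
open Literature.Probability.LatticeModels
open Literature.Probability.LatticeModels.DobrushinMetric
open Literature.MathematicalPhysics.QuantumLattice
open Literature.MathematicalPhysics.QuantumFieldTheory hiding ZdEdge

namespace Summit.Ventures.YMGap.StrongCouplingAllGroupsSharp

/-! ## 1. Two distinct links lie on at most one plaquette -/

section Combinatorics
variable {d : ℕ}
/-- Membership in `plaquetteEdges`, unfolded into the four cases. [folklore] -/
theorem mem_plaquetteEdges_iff {p : ZdPlaquette d} {e : ZdEdge d} :
    e ∈ plaquetteEdges p ↔ e = (p.1, p.2.1.1) ∨ e = (p.1 + Pi.single p.2.1.1 1, p.2.1.2) ∨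
      e = (p.1 + Pi.single p.2.1.2 1, p.2.1.1) ∨ e = (p.1, p.2.1.2) := by
  simp only [plaquetteEdges, Finset.mem_insert, Finset.mem_singleton]

/-- **The base point of a plaquette is the coordinatewise minimum of the base points of any two distinct links on it.**
[folklore] -/
theorem fst_apply_eq_min {p : ZdPlaquette d} {x y : ZdEdge d} (hx : x ∈ plaquetteEdges p)
    (hy : y ∈ plaquetteEdges p) (hxy : x ≠ y) (k : Fin d) : p.1 k = min (x.1 k) (y.1 k) := by
  have hij : p.2.1.1 ≠ p.2.1.2 := p.2.2.ne
  rw [mem_plaquetteEdges_iff] at hx hy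
  rcases hx with rfl | rfl | rfl | rfl <;> rcases hy with rfl | rfl | rfl | rfl <;>
    first
    | exact absurd rfl hxy
    | (simp only [Pi.add_apply, Pi.single_apply]
       by_cases h1 : k = p.2.1.1 <;> by_cases h2 : k = p.2.1.2 <;>
         first
         | exact absurd (h1.symm.trans h2) hij
         | (simp [h1, h2, hij, hij.symm]; try omega))

/-- **The two directions of a plaquette are read off from any two distinct links on it**: they are the directions of
the links together with the coordinates in which the base points differ. [folklore] -/
theorem dirs_eq {p : ZdPlaquette d} {x y : ZdEdge d} (hx : x ∈ plaquetteEdges p) (hy : y ∈ plaquetteEdges p)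
    (hxy : x ≠ y) :
    ({p.2.1.1, p.2.1.2} : Finset (Fin d)) = {x.2, y.2} ∪ Finset.univ.filter fun k => x.1 k ≠ y.1 k := by
  have hij : p.2.1.1 ≠ p.2.1.2 := p.2.2.ne
  rw [mem_plaquetteEdges_iff] at hx hy
  rcases hx with rfl | rfl | rfl | rfl <;> rcases hy with rfl | rfl | rfl | rfl <;>
    first
    | exact absurd rfl hxy
    | (ext k
       simp only [Finset.mem_insert, Finset.mem_singleton, Finset.mem_union, Finset.mem_filter, Finset.mem_univ,
         true_and, Pi.add_apply, Pi.single_apply, ne_eq]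
       by_cases h1 : k = p.2.1.1 <;> by_cases h2 : k = p.2.1.2 <;>
         first
         | exact absurd (h1.symm.trans h2) hij
         | simp [h1, h2, hij, hij.symm])

/-- ★ **Two distinct links lie on at most one common plaquette**: if `x ≠ y` both belong to the plaquettes `p` and `p'`,
then `p = p'` (base point and directions are determined by `x`, `y`: `fst_apply_eq_min`, `dirs_eq`). [folklore] -/
theorem eq_of_mem_plaquetteEdges {p p' : ZdPlaquette d} {x y : ZdEdge d} (hxy : x ≠ y)
    (hx : x ∈ plaquetteEdges p) (hy : y ∈ plaquetteEdges p) (hx' : x ∈ plaquetteEdges p')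
    (hy' : y ∈ plaquetteEdges p') : p = p' := by
  have h1 : p.1 = p'.1 := funext fun k => by rw [fst_apply_eq_min hx hy hxy k, fst_apply_eq_min hx' hy' hxy k]
  have hdirs : ({p.2.1.1, p.2.1.2} : Finset (Fin d)) = {p'.2.1.1, p'.2.1.2} := by
    rw [dirs_eq hx hy hxy, dirs_eq hx' hy' hxy]
  have hij : p.2.1.1 < p.2.1.2 := p.2.2
  have hij' : p'.2.1.1 < p'.2.1.2 := p'.2.2
  have hi : p.2.1.1 ∈ ({p'.2.1.1, p'.2.1.2} : Finset (Fin d)) := hdirs ▸ by simp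
  have hj : p.2.1.2 ∈ ({p'.2.1.1, p'.2.1.2} : Finset (Fin d)) := hdirs ▸ by simp
  have hi' : p'.2.1.1 ∈ ({p.2.1.1, p.2.1.2} : Finset (Fin d)) := hdirs ▸ by simp
  have hj' : p'.2.1.2 ∈ ({p.2.1.1, p.2.1.2} : Finset (Fin d)) := hdirs ▸ by simp
  simp only [Finset.mem_insert, Finset.mem_singleton] at hi hj hi' hj'
  have h2 : p.2.1 = p'.2.1 := by
    refine Prod.ext ?_ ?_
    · rcases hi with h | h
      · exact h
      · rcases hi' with h' | h'
        · exact h'.symm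
        · exfalso
          rw [h] at hij
          rw [h'] at hij'
          exact lt_asymm hij hij'
    · rcases hj with h | h
      · rcases hj' with h' | h'
        · exfalso
          rw [h] at hij
          rw [h'] at hij'
          exact lt_asymm hij hij'
        · exact h'.symm
      · exact h
  exact Prod.ext h1 (Subtype.ext h2)

/-- ★ **At most one plaquette contains two given distinct links**: `#{p ∈ plaquettesTouching {x} | y ∈ p} ≤ 1` for
`x ≠ y`. [folklore] -/
theorem card_filter_pair_le_one [DecidableEq (ZdEdge d)] {x y : ZdEdge d} (hxy : x ≠ y) :
    ((plaquettesTouching ({x} : Finset (ZdEdge d))).filter fun p => y ∈ plaquetteEdges p).card ≤ 1 := by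
  refine Finset.card_le_one.2 fun p hp p' hp' => ?_
  rw [Finset.mem_filter, mem_plaquettesTouching_singleton] at hp hp'
  exact eq_of_mem_plaquetteEdges hxy hp.1 hp.2 hp'.1 hp'.2


end Combinatorics

/-! ## 2. The sharp oscillation of the one-link Wilson energy -/

section Wilson

variable {d N : ℕ} {G : Type} [Group G] (ρ : G →* Matrix (Fin N) (Fin N) ℂ)

/-- ★ **Sharp oscillation of the one-link Wilson energy under a change of ONE other link**: if `|Re tr ρ(U_p)| ≤ C`
and `U`, `U'` agree off the link `y ≠ x`, then `|S_{x}(U) − S_{x}(U')| ≤ 2C` — only the (at most one) plaquette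
through both `x` and `y` contributes (versus `2C · 2(d−1)` in file 1's `abs_wilsonBoundaryAction_singleton_sub_le`).
[folklore] -/
theorem abs_wilsonBoundaryAction_singleton_sub_le_sharp {C : ℝ} (hC0 : 0 ≤ C)
    (hC : ∀ (z : Site d) (i j : Fin d) (U : LGConfig d G), |plaquetteObs ρ z i j U| ≤ C)
    {x y : ZdEdge d} (hxy : x ≠ y) {U U' : LGConfig d G} (hU : ∀ e, e ≠ y → U e = U' e) :
    |wilsonBoundaryAction ρ {x} U - wilsonBoundaryAction ρ {x} U'| ≤ 2 * C := by
  classical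
  unfold wilsonBoundaryAction
  rw [← Finset.sum_sub_distrib]
  -- only plaquettes through `y` contribute
  have hvan : ∀ p ∈ plaquettesTouching ({x} : Finset (ZdEdge d)), y ∉ plaquetteEdges p →
      ((N : ℝ) - plaquetteObs ρ p.1 p.2.1.1 p.2.1.2 U) - ((N : ℝ) - plaquetteObs ρ p.1 p.2.1.1 p.2.1.2 U') = 0 := by
    intro p _ hyp
    have h : plaquetteObs ρ p.1 p.2.1.1 p.2.1.2 U = plaquetteObs ρ p.1 p.2.1.1 p.2.1.2 U' :=
      isCylinder_plaquetteObs ρ p fun e he => hU e fun hey => hyp (by rw [← hey]; exact he)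
    rw [h, sub_self]
  have hsplit : ∑ p ∈ plaquettesTouching ({x} : Finset (ZdEdge d)),
      (((N : ℝ) - plaquetteObs ρ p.1 p.2.1.1 p.2.1.2 U) - ((N : ℝ) - plaquetteObs ρ p.1 p.2.1.1 p.2.1.2 U')) =
      ∑ p ∈ (plaquettesTouching ({x} : Finset (ZdEdge d))).filter (fun p => y ∈ plaquetteEdges p),
        (((N : ℝ) - plaquetteObs ρ p.1 p.2.1.1 p.2.1.2 U) - ((N : ℝ) - plaquetteObs ρ p.1 p.2.1.1 p.2.1.2 U')) :=
    (Finset.sum_filter_of_ne fun p hp hne => by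
      by_contra hyp
      exact hne (hvan p hp hyp)).symm
  rw [hsplit]
  refine (Finset.abs_sum_le_sum_abs _ _).trans ?_
  refine (Finset.sum_le_card_nsmul _ _ (2 * C) fun p _ => ?_).trans ?_
  · have h1 := hC p.1 p.2.1.1 p.2.1.2 U
    have h2 := hC p.1 p.2.1.1 p.2.1.2 U'
    rw [abs_le] at h1 h2 ⊢
    constructor <;> linarith
  · rw [nsmul_eq_mul]
    have hcard : (((plaquettesTouching ({x} : Finset (ZdEdge d))).filter fun p => y ∈ plaquetteEdges p).card : ℝ)
        ≤ 1 := by exact_mod_cast card_filter_pair_le_one hxy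
    nlinarith

end Wilson

/-! ## 3. Dobrushin's condition and DLR uniqueness at `6(d−1) C_ρ |β| < 1`, every compact gauge group -/

variable {d N : ℕ} {G : Type} [Group G] [TopologicalSpace G] [IsTopologicalGroup G] [CompactSpace G]
  [MeasurableSpace G] [BorelSpace G] [SecondCountableTopology G] (ρ : G →* Matrix (Fin N) (Fin N) ℂ)

/-- ★ **Dobrushin's condition, total-variation form, SHARP coefficient `C |β|`, every compact gauge group**: the
one-link laws at boundary conditions differing at one plaquette neighbour `y` are tilts of Haar measure by exponents
`2 C |β|`-close in sup norm (`abs_wilsonBoundaryAction_singleton_sub_le_sharp`), hence `C |β| · L`-close on observables of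
oscillation `≤ L` (Simon's lemma `abs_integral_tilted_sub_integral_tilted_le_linear'`).
[cite: Simon1979Dobrushin, Lemma and Remark 2] -/
theorem isKRContraction_ymSpecification_sharp (hρ : Continuous ρ) {C : ℝ} (hC0 : 0 ≤ C)
    (hC : ∀ (z : Site d) (i j : Fin d) (U : LGConfig d G), |plaquetteObs ρ z i j U| ≤ C) (β : ℝ) :
    IsKRContraction (ymSpecification (d := d) ρ β) (fun _ _ => (1 : ℝ)) linkPlaqNbr (fun _ _ => C * |β|) := by
  classical
  refine isKRContraction_ymSpecification ρ hρ β (fun _ _ => by positivity) ?_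
  intro x y hy ω η hωη φ L hφm hφb hL hφL
  have hxy : x ≠ y := by
    rintro rfl
    exact not_mem_linkPlaqNbr _ hy
  rw [siteLaw_ymSpecification_eq_tilted_haar ρ hρ β x ω, siteLaw_ymSpecification_eq_tilted_haar ρ hρ β x η]
  have hcont : ∀ ζ : LGConfig d G,
      Continuous fun g : G => -β * wilsonBoundaryAction ρ {x} (Function.update ζ x g) := fun ζ =>
    continuous_const.mul ((continuous_wilsonBoundaryAction ρ hρ {x}).comp
      (continuous_const.update x continuous_id))
  have hbdd : ∀ ζ : LGConfig d G,
      ∃ B, ∀ g : G, |-β * wilsonBoundaryAction ρ {x} (Function.update ζ x g)| ≤ B := fun ζ => by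
    refine ⟨|β| * (((N : ℝ) + C) * (plaquettesTouching ({x} : Finset (ZdEdge d))).card), fun g => ?_⟩
    rw [abs_mul, abs_neg]
    exact mul_le_mul_of_nonneg_left (abs_wilsonBoundaryAction_le ρ hC {x} _) (abs_nonneg β)
  have hε : ∀ g : G, |-β * wilsonBoundaryAction ρ {x} (Function.update ω x g) -
      -β * wilsonBoundaryAction ρ {x} (Function.update η x g)| ≤ |β| * (2 * C) := by
    intro g
    have hU : ∀ e, e ≠ y → Function.update ω x g e = Function.update η x g e := by
      intro e he
      by_cases hex : e = x
      · subst hex; simp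
      · rw [Function.update_of_ne hex, Function.update_of_ne hex, hωη e he]
    have h := abs_wilsonBoundaryAction_singleton_sub_le_sharp ρ hC0 hC hxy hU
    rw [← mul_sub, abs_mul, abs_neg]
    exact mul_le_mul_of_nonneg_left h (abs_nonneg β)
  have key := abs_integral_tilted_sub_integral_tilted_le_linear' (haarProbability G)
    (hcont ω).measurable (hcont η).measurable (hbdd ω) (hbdd η) hε hφm hφb (L := L)
    (fun a b => by simpa using hφL a b)
  refine key.trans (le_of_eq ?_)
  ring

section Unique

variable [T2Space G]

/-- Sharp Dobrushin row sums: `≤ 6(d−1) C |β|` (`card_linkPlaqNbr_le`). [folklore] -/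
theorem row_sum_le_sharp {C β : ℝ} (hC0 : 0 ≤ C) (x : ZdEdge d) :
    ∑ _y ∈ linkPlaqNbr x, C * |β| ≤ 6 * ((d - 1 : ℕ) : ℝ) * C * |β| := by
  rw [Finset.sum_const, nsmul_eq_mul]
  have hcard : ((linkPlaqNbr x).card : ℝ) ≤ ((6 * (d - 1 : ℕ) : ℕ) : ℝ) := by
    exact_mod_cast card_linkPlaqNbr_le x
  calc ((linkPlaqNbr x).card : ℝ) * (C * |β|) ≤ ((6 * (d - 1 : ℕ) : ℕ) : ℝ) * (C * |β|) :=
        mul_le_mul_of_nonneg_right hcard (by positivity)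
    _ = 6 * ((d - 1 : ℕ) : ℝ) * C * |β| := by push_cast; ring

/-- ★ **DLR uniqueness at `6(d−1) C |β| < 1`, every compact gauge group** (Föllmer's Dobrushin theorem in the
Vasserstein form for the discrete weight; Urysohn metric on `G` for the measurability bookkeeping, as in file 1).
[cite: Follmer1988, Ch. I Uniqueness theorem (2.9)] -/
theorem subsingleton_ymGibbsMeasures_sharp (hρ : Continuous ρ) {C : ℝ} (hC0 : 0 ≤ C)
    (hC : ∀ (z : Site d) (i j : Fin d) (U : LGConfig d G), |plaquetteObs ρ z i j U| ≤ C) {β : ℝ}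
    (hβ : 6 * ((d - 1 : ℕ) : ℝ) * C * |β| < 1) :
    (ymGibbsMeasures (d := d) ρ β).Subsingleton := by
  letI m : MetricSpace G := TopologicalSpace.metrizableSpaceMetric G
  have hγ : IsSpecification (ymSpecification (d := d) ρ β) := isSpecification_ymSpecification_of_t2Space ρ hρ β
  have hKR := isKRContraction_ymSpecification_sharp (d := d) ρ hρ hC0 hC β
  obtain ⟨D, hD⟩ : ∃ D : ℝ, ∀ a b : G, dist a b ≤ D := by
    obtain ⟨D, hD⟩ := (isCompact_univ (X := G)).isBounded.subset_closedBall (1 : G)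
    refine ⟨D + D, fun a b => ?_⟩
    have ha := hD (Set.mem_univ a)
    have hb := hD (Set.mem_univ b)
    rw [Metric.mem_closedBall] at ha hb
    calc dist a b ≤ dist a 1 + dist 1 b := dist_triangle _ _ _
      _ ≤ D + D := by rw [dist_comm 1 b]; exact add_le_add ha hb
  have hD0 : 0 ≤ D := dist_nonneg.trans (hD 1 1)
  exact subsingleton_gibbsMeasures_of_isKRContraction (M := G) hγ hKR (fun _ _ => zero_le_one)
    (fun _ _ => le_rfl) id (by rw [MeasurableSpace.comap_id]) hD0 (fun a b => by simpa using hD a b)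
    (by positivity) hβ (fun x => row_sum_le_sharp hC0 x)

/-- ★ **`|𝒢(β)| = 1` at `6(d−1) C |β| < 1`, every compact gauge group.** [folklore] -/
theorem hasUniqueGibbsMeasure_sharp (hρ : Continuous ρ) {C : ℝ} (hC0 : 0 ≤ C)
    (hC : ∀ (z : Site d) (i j : Fin d) (U : LGConfig d G), |plaquetteObs ρ z i j U| ≤ C) {β : ℝ}
    (hβ : 6 * ((d - 1 : ℕ) : ℝ) * C * |β| < 1) :
    HasUniqueGibbsMeasure (ymSpecification (d := d) ρ β) :=
  ⟨subsingleton_ymGibbsMeasures_sharp ρ hρ hC0 hC hβ, ymGibbsMeasures_nonempty ρ hρ β⟩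

/-- Solved form: `|β| < 1/(6(d−1) C)` (`d ≥ 2`, `C > 0`) gives `|𝒢(β)| = 1`. [folklore] -/
theorem hasUniqueGibbsMeasure_sharp_of_abs_lt (hρ : Continuous ρ) {C : ℝ} (hCpos : 0 < C)
    (hC : ∀ (z : Site d) (i j : Fin d) (U : LGConfig d G), |plaquetteObs ρ z i j U| ≤ C) (hd : 2 ≤ d) {β : ℝ}
    (hβ : |β| < 1 / (6 * ((d : ℝ) - 1) * C)) :
    HasUniqueGibbsMeasure (ymSpecification (d := d) ρ β) := by
  refine hasUniqueGibbsMeasure_sharp ρ hρ hCpos.le hC ?_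
  have hd1 : ((d - 1 : ℕ) : ℝ) = (d : ℝ) - 1 := by rw [Nat.cast_sub (by omega)]; simp
  rw [hd1]
  have hpos : 0 < 6 * ((d : ℝ) - 1) * C := by
    have : (1 : ℝ) ≤ (d : ℝ) - 1 := by
      have : (2 : ℝ) ≤ d := by exact_mod_cast hd
      linarith
    positivity
  rwa [lt_div_iff₀ hpos, mul_comm] at hβ

/-- ★ **In the corner THE DLR state is the thermodynamic limit of the torus states, every compact gauge group**: for
`6(d−1) C |β| < 1` and `μ ∈ 𝒢(β)`, the FULL sequence of torus Wilson states converges to `μ` on every bounded continuous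
observable (uniqueness + compactness, `tendsto_integral_torusState_of_subsingleton`). [cite: FriedliVelenikSMLS2017, Lemma 6.30] -/
theorem tendsto_integral_torusState_sharp (hρ : Continuous ρ) {C : ℝ} (hC0 : 0 ≤ C)
    (hC : ∀ (z : Site d) (i j : Fin d) (U : LGConfig d G), |plaquetteObs ρ z i j U| ≤ C) {β : ℝ}
    (hβ : 6 * ((d - 1 : ℕ) : ℝ) * C * |β| < 1) {μ : Measure (LGConfig d G)} (hμ : μ ∈ ymGibbsMeasures (d := d) ρ β)
    {f : LGConfig d G → ℝ} (hf : Continuous f) {K : ℝ} (hK : ∀ U, |f U| ≤ K) :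
    Tendsto (fun L : ℕ => ∫ U, f U ∂(torusState ρ β (L + 1))) atTop (𝓝 (∫ U, f U ∂μ)) :=
  tendsto_integral_torusState_of_subsingleton ρ hρ (subsingleton_ymGibbsMeasures_sharp ρ hρ hC0 hC hβ) hμ hf hK

/-- ★ **In the corner the DLR state is translation invariant, every compact gauge group** (it is a torus limit point;
`PressureRegularity.isZdTranslationInvariant_of_subsingleton`). [folklore] -/
theorem isZdTranslationInvariant_sharp (hρ : Continuous ρ) {C : ℝ} (hC0 : 0 ≤ C)
    (hC : ∀ (z : Site d) (i j : Fin d) (U : LGConfig d G), |plaquetteObs ρ z i j U| ≤ C) {β : ℝ}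
    (hβ : 6 * ((d - 1 : ℕ) : ℝ) * C * |β| < 1) {μ : Measure (LGConfig d G)} (hμ : μ ∈ ymGibbsMeasures (d := d) ρ β) :
    IsZdTranslationInvariant μ :=
  PressureRegularity.isZdTranslationInvariant_of_subsingleton ρ hρ (subsingleton_ymGibbsMeasures_sharp ρ hρ hC0 hC hβ) hμ

end Unique

/-! ## 4. Rows: unitary representations, `U(1)`, `SU(N)` -/

section Rows

variable [T2Space G]

/-- **Unitary representations** (`C = N`): `|𝒢(β)| = 1` whenever `6(d−1) N |β| < 1`. [folklore] -/
theorem hasUniqueGibbsMeasure_sharp_of_unitary (hρ : Continuous ρ)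
    (hρu : ∀ g, ρ g ∈ Matrix.unitaryGroup (Fin N) ℂ) {β : ℝ} (hβ : 6 * ((d - 1 : ℕ) : ℝ) * N * |β| < 1) :
    HasUniqueGibbsMeasure (ymSpecification (d := d) ρ β) :=
  hasUniqueGibbsMeasure_sharp ρ hρ (Nat.cast_nonneg N) (abs_plaquetteObs_le_holds ρ hρu) hβ


end Rows

section U1

variable [MeasurableSpace Circle] [BorelSpace Circle]

/-- ★ **Compact `U(1)`: a unique DLR state at `6(d−1) |β| < 1`** (`d = 4`: `|β| < 1/18`; `d = 3`: `|β| < 1/12`).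
[folklore] -/
theorem u1_hasUniqueGibbsMeasure_sharp {β : ℝ} (hβ : 6 * ((d - 1 : ℕ) : ℝ) * |β| < 1) :
    HasUniqueGibbsMeasure (ymSpecification (d := d) u1Rep β) := by
  have h := hasUniqueGibbsMeasure_sharp_of_unitary (d := d) u1Rep continuous_u1Rep u1Rep_mem_unitaryGroup (β := β)
  simp only [Nat.cast_one, mul_one] at h
  exact h hβ

/-- `U(1)`, `d = 4`: a unique DLR state for `|β| < 1/18`. [folklore] -/
theorem u1_four_hasUniqueGibbsMeasure_sharp {β : ℝ} (hβ : |β| < 1 / 18) :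
    HasUniqueGibbsMeasure (ymSpecification (d := 4) u1Rep β) :=
  u1_hasUniqueGibbsMeasure_sharp (d := 4) (by norm_num; linarith)

/-- `U(1)`, `d = 3`: a unique DLR state for `|β| < 1/12`. [folklore] -/
theorem u1_three_hasUniqueGibbsMeasure_sharp {β : ℝ} (hβ : |β| < 1 / 12) :
    HasUniqueGibbsMeasure (ymSpecification (d := 3) u1Rep β) :=
  u1_hasUniqueGibbsMeasure_sharp (d := 3) (by norm_num; linarith)


end U1

section Zn

variable [MeasurableSpace Circle] [BorelSpace Circle]

/-- ★ **Discrete gauge groups `ℤ_n` (`n`-th roots of unity in `U(1)`, representation `znRep n`), every `n`, every `d`**: a unique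
DLR state at `6(d−1) |β| < 1` — `d = 4`: `|β| < 1/18` (e.g. `ℤ₂` = Ising lattice gauge theory, whose `d = 4` transition sits
near `β ≈ 0.44`); `znRep` is unitary of degree `1`. [folklore] -/
theorem zn_hasUniqueGibbsMeasure_sharp (n : ℕ) {β : ℝ} (hβ : 6 * ((d - 1 : ℕ) : ℝ) * |β| < 1) :
    HasUniqueGibbsMeasure (ymSpecification (d := d) (Literature.Barriers.QuantumFields.znRep n) β) := by
  have h := hasUniqueGibbsMeasure_sharp_of_unitary (d := d) (Literature.Barriers.QuantumFields.znRep n)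
    (Literature.Barriers.QuantumFields.continuous_znRep n) (Literature.Barriers.QuantumFields.znRep_mem_unitaryGroup n)
    (β := β)
  simp only [Nat.cast_one, mul_one] at h
  exact h hβ

/-- `ℤ_n`, `d = 4`: a unique DLR state for `|β| < 1/18`, every `n`. [folklore] -/
theorem zn_four_hasUniqueGibbsMeasure_sharp (n : ℕ) {β : ℝ} (hβ : |β| < 1 / 18) :
    HasUniqueGibbsMeasure (ymSpecification (d := 4) (Literature.Barriers.QuantumFields.znRep n) β) :=
  zn_hasUniqueGibbsMeasure_sharp (d := 4) n (by norm_num; linarith)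

end Zn

section SUN

/-- `SU(N) ⊆ M_N(ℂ)` is second countable. [folklore] -/
private theorem suN_secondCountableTopology (N : ℕ) : SecondCountableTopology (Matrix.specialUnitaryGroup (Fin N) ℂ) :=
  haveI : SecondCountableTopology (Matrix (Fin N) (Fin N) ℂ) :=
    inferInstanceAs (SecondCountableTopology (Fin N → Fin N → ℂ))
  Topology.IsEmbedding.subtypeVal.secondCountableTopology

/-- **`SU(N)`, fundamental representation**: `|𝒢(β)| = 1` at `6(d−1) N |β| < 1` (tree coupling) — the every-group
formula's value; WEAKER than the tree's `SU(N)` windows. [folklore] -/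
theorem suN_hasUniqueGibbsMeasure_sharp {N : ℕ} {β : ℝ} (hβ : 6 * ((d - 1 : ℕ) : ℝ) * N * |β| < 1) :
    HasUniqueGibbsMeasure (ymSpecification (d := d) (fundamentalRep (Fin N)) β) :=
  haveI := suN_secondCountableTopology N
  hasUniqueGibbsMeasure_sharp_of_unitary (d := d) (fundamentalRep (Fin N)) (continuous_fundamentalRep (Fin N))
    fundamentalRep_mem_unitaryGroup hβ

/-- `SU(2)`, `d = 4`: `|𝒢(β)| = 1` for `|β| < 1/36` by the every-group formula (tree units; `β_W < 1/18`).
[folklore] -/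
theorem su2_four_hasUniqueGibbsMeasure_sharp {β : ℝ} (hβ : |β| < 1 / 36) :
    HasUniqueGibbsMeasure (ymSpecification (d := 4) (fundamentalRep (Fin 2)) β) :=
  suN_hasUniqueGibbsMeasure_sharp (d := 4) (N := 2) (by norm_num; linarith)

end SUN

end Summit.Ventures.YMGap.StrongCouplingAllGroupsSharp

end
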